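import Summits.CriticalPhenomena.SAWScalingLimit.Theorems.SAWDevelopingMapNoFoldBoundThreeClassNec
import Summits.CriticalPhenomena.SAWScalingLimit.Theorems.SAWDevelopingMapNoFoldBoundDepthTwoPort
import Summits.CriticalPhenomena.SAWScalingLimit.Theorems.SAWDevelopingMapNoFoldBoundInteriorCore

/-!
# `NoFoldBound`, line Ideator3Sketch — depth-2 stratum: no middle-port starvation under `NoFoldBound`

Crux `NoFoldBound` (stmt-CriticalPhenomena-8296), route `SAWDevelopingMap`, lead seat c5 (wave 1, stub
`noStarvation_of_noFoldBound`). This is the CONVERSE direction of `depthTwo_core` (file `…DepthTwoPort`): at an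
interior vertex `v` off the source with a neighbour `w₀ ∉ a` touching the complement (`w₀ ∼ x ∉ Λ`, third
neighbour `y`, positive labelling `(w₀, w₁, w₂)`), the uniform no-fold bound FORCES the middle port not to be
starved when the two outer ports are balanced: with `s_j` the dressed sum-masses of the three ports,
`2·min(s_outer, s_outer') ≤ 3·s_mid + max(s_outer, s_outer')` (middle port `w₁` if `y → w₀ → v` turns left,
`w₂` if it turns right).

Proof: `slitCoherence_of_noFoldBound` turns `NoFoldBound` into the slit-coherence inequality
`‖B₀ + ω B₁ + ω² B₂‖ ≤ k ‖S₀ + S₁ + S₂‖` (`k < 1`) for the dressed port sums; the rigid classes of the depth-2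
stratum (`depthTwo_classes`, `depthTwo_portClass`) and the phase factorisation of `depthTwo_core` reduce it to
the three-class form `‖b_mid + b_hi e^{13πi/12} + b_lo e^{−13πi/12}‖ ≤ k ‖s_mid + s_hi e^{5πi/12} + s_lo e^{−5πi/12}‖`
for the real dressed masses. `sourceLoopBound_of_noFoldBound` bounds every slit loop sum by `c < sin(π/8)`,
whence the one-sided dressing facts `b_j ≤ s_j` (as `α_T − β_T = 2√3 x_c sin(π/8)`) and `b_j ≥ 0.6137 s_j`
(as `β_T ≥ 0.6137 α_T`), and `three_class_necessary` concludes. [folklore assembly]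
-/

noncomputable section

open scoped BigOperators
open Literature.Probability.LatticeModels Literature.Probability.RandomPlanarGeometry.SAW

namespace Summit.CriticalPhenomena.SAWScalingLimit.Theorems.SAWDevelopingMapNoFoldBound

/-! ## Numerics of the one-sided dressing -/

/-- `β_T ≥ 0.6137 α_T` (`β_T ≥ 1.14101`, `0.6137 α_T ≤ 1.14083`). [folklore] -/
theorem betaT_ge_alphaT_mul :
    6137 / 10000 * (1 + 2 * hexCriticalFugacity * Real.cos (5 * Real.pi / 24)) ≤
      1 + 2 * hexCriticalFugacity * Real.cos (11 * Real.pi / 24) := by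
  obtain ⟨hxl, hxu⟩ := xc_bounds
  obtain ⟨h5l, h5u⟩ := cos_five_pi_div_24_bounds
  obtain ⟨h11l, h11u⟩ := cos_eleven_pi_div_24_bounds
  set x := hexCriticalFugacity with hx
  have x0 : 0 ≤ x := by linarith
  have hα_u : 2 * x * Real.cos (5 * Real.pi / 24) ≤ 2 * 0.5413 * 0.7934 := by
    have := mul_le_mul hxu h5u (by linarith) (by norm_num : (0 : ℝ) ≤ 0.5413); nlinarith
  have hβ_l : 2 * 0.5411 * 0.1303 ≤ 2 * x * Real.cos (11 * Real.pi / 24) := by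
    have := mul_le_mul hxl h11l (by norm_num) x0; nlinarith
  nlinarith

/-- **One-sided dressing facts.** For a slit loop sum `0 ≤ Z ≤ c < sin(π/8)`: the sum-mode mass is
nonnegative, `0 ≤ α_T − √3 x_c Z`; the Beltrami mass dominates `0.6137` of it,
`0.6137 (α_T − √3 x_c Z) ≤ β_T + √3 x_c Z`; and is at most the sum-mode mass,
`β_T + √3 x_c Z ≤ 1 · (α_T − √3 x_c Z)` (as `α_T − β_T = 2 √3 x_c sin(π/8)`). [folklore] -/
theorem dressed_oneSided {c Z : ℝ} (hc : c < Real.sin (Real.pi / 8)) (hZ0 : 0 ≤ Z) (hZc : Z ≤ c) :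
    0 ≤ (1 + 2 * hexCriticalFugacity * Real.cos (5 * Real.pi / 24)) - Real.sqrt 3 * hexCriticalFugacity * Z ∧
    6137 / 10000 * ((1 + 2 * hexCriticalFugacity * Real.cos (5 * Real.pi / 24)) -
        Real.sqrt 3 * hexCriticalFugacity * Z) ≤
      (1 + 2 * hexCriticalFugacity * Real.cos (11 * Real.pi / 24)) + Real.sqrt 3 * hexCriticalFugacity * Z ∧
    (1 + 2 * hexCriticalFugacity * Real.cos (11 * Real.pi / 24)) + Real.sqrt 3 * hexCriticalFugacity * Z ≤
      1 * ((1 + 2 * hexCriticalFugacity * Real.cos (5 * Real.pi / 24)) -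
        Real.sqrt 3 * hexCriticalFugacity * Z) := by
  have hβ := betaT_ge_alphaT_mul
  have hαβ := alphaT_sub_betaT
  have x0 : 0 ≤ hexCriticalFugacity := nfb_xc_pos.le
  have hsx : 0 ≤ Real.sqrt 3 * hexCriticalFugacity := mul_nonneg (Real.sqrt_nonneg _) x0
  have hZx0 : 0 ≤ Real.sqrt 3 * hexCriticalFugacity * Z := mul_nonneg hsx hZ0
  have hZs : Real.sqrt 3 * hexCriticalFugacity * Z ≤ Real.sqrt 3 * hexCriticalFugacity * Real.sin (Real.pi / 8) :=
    mul_le_mul_of_nonneg_left (hZc.trans hc.le) hsx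
  refine ⟨(dressed_le hc hZ0 hZc).2, by nlinarith, by nlinarith⟩

/-! ## The depth-2 converse -/

/-- **No middle-port starvation at depth 2 under `NoFoldBound` (touching neighbour in position `w₀`,
positive labelling).** Let `Λ` be simply connected with source `a ∈ ∂Ω`, `v ∈ Λ` off `a` with pairwise
distinct neighbours `w₀, w₁, w₂ ∈ Λ` in the positive order (turn `w₀ → v → w₁ = +π/3`), `w₀` off `a` TOUCHING the
complement: `w₀ ∼ x ∉ Λ` (`x ≠ v`) with third neighbour `y`. If the uniform no-fold bound `NoFoldBound` holds,
then the dressed sum-masses `s` of the three ports satisfy `2·min(s(w₀), s(w₂)) ≤ 3·s(w₁) + max(s(w₀), s(w₂))`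
if `y → w₀ → v` turns left (middle port `w₁`) and `2·min(s(w₀), s(w₁)) ≤ 3·s(w₂) + max(s(w₀), s(w₁))` if it
turns right (middle port `w₂`): the converse companion of the dominance hypothesis of `depthTwo_core`.
[folklore assembly] -/
theorem noStarvation_of_noFoldBound
    (hK : Summit.CriticalPhenomena.SAWScalingLimit.Theses.SAWDevelopingMap.NoFoldBound) :
    ∀ (Λ : Finset HexVertex), hexDomainSimplyConnected Λ → ∀ a ∈ hexDomainBoundary Λ,
      ∀ v ∈ Λ, v ∉ a → ∀ w₀ w₁ w₂ x y : HexVertex, hexGraph.Adj v w₀ → hexGraph.Adj v w₁ →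
      hexGraph.Adj v w₂ → w₀ ≠ w₁ → w₁ ≠ w₂ → w₀ ≠ w₂ → w₀ ∈ Λ → w₁ ∈ Λ → w₂ ∈ Λ → w₀ ∉ a →
      winding [hexMidpoint s(w₀, v), hexCenter v, hexMidpoint s(v, w₁)] = Real.pi / 3 →
      hexGraph.Adj w₀ x → hexGraph.Adj w₀ y → v ≠ x → x ≠ y → v ≠ y → x ∉ Λ →
      let xc : ℝ := hexCriticalFugacity
      let α : ℝ := 1 + 2 * hexCriticalFugacity * Real.cos (5 * Real.pi / 24)
      let s : (w p q : HexVertex) → ℝ := fun w p q =>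
        ∑ γ : HexMidEdgeSAW Λ a s(v, w), if v ∉ γ.verts then xc ^ γ.length *
          (α - Real.sqrt 3 * xc *
            ∑ δ : HexMidEdgeSAW ((Λ \ γ.verts.toFinset).erase v) s(v, p) s(v, q), xc ^ δ.length) else 0
      (winding [hexMidpoint s(y, w₀), hexCenter w₀, hexMidpoint s(w₀, v)] = Real.pi / 3 →
          2 * min (s w₀ w₁ w₂) (s w₂ w₀ w₁) ≤ 3 * s w₁ w₂ w₀ + max (s w₀ w₁ w₂) (s w₂ w₀ w₁)) ∧
        (winding [hexMidpoint s(y, w₀), hexCenter w₀, hexMidpoint s(w₀, v)] = -(Real.pi / 3) →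
          2 * min (s w₀ w₁ w₂) (s w₁ w₂ w₀) ≤ 3 * s w₂ w₀ w₁ + max (s w₀ w₁ w₂) (s w₁ w₂ w₀)) := by
  intro Λ hΛ a ha v hv hva w₀ w₁ w₂ xo y h₀ h₁ h₂ h₀₁ h₁₂ h₀₂ hw₀ hw₁ hw₂ hw₀a hchir hwx hwy hvx hxy hvy
    hx
  dsimp only
  -- the two consequences of `NoFoldBound`: slit coherence (`k < 1`) and the slit-loop bound (`c < sin(π/8)`)
  obtain ⟨k, hk, H⟩ := slitCoherence_of_noFoldBound stub_portRenewal stub_slitSC hK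
  obtain ⟨c, hc, HL⟩ := sourceLoopBound_of_noFoldBound hK
  have hint : ∀ u : HexVertex, hexGraph.Adj v u → u ∈ Λ := by
    intro u hvu
    rcases adj_cases h₀ h₁ h₂ h₀₁ h₁₂ h₀₂ hvu with rfl | rfl | rfl
    · exact hw₀
    · exact hw₁
    · exact hw₂
  have H1 := H Λ hΛ a ha v hv hva hint w₀ w₁ w₂ h₀ h₁ h₂ h₀₁ h₁₂ h₀₂ hchir
  clear H
  dsimp only at H1
  -- the turns at `v` from the chirality
  obtain ⟨ε, hε, T01, -, T20, T10, -, -⟩ := stub_localTurns v w₀ w₁ w₂ h₀ h₁ h₂ h₀₁ h₁₂ h₀₂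
  have hε1 : ε = 1 := by
    rcases hε with h | h
    · exact h
    · exfalso
      rw [h] at T01
      have := Real.pi_pos
      linarith [T01.symm.trans hchir]
  subst hε1
  simp only [one_mul] at T20 T10
  -- the turns at `w₀` (neighbours `y, v, x`)
  obtain ⟨ε', hε', Tyv, Tvx, -, -, -, Tyx⟩ :=
    stub_localTurns w₀ y v xo hwy h₀.symm hwx hvy.symm hvx hxy.symm
  set x := hexCriticalFugacity with hxc
  set α : ℝ := 1 + 2 * x * Real.cos (5 * Real.pi / 24) with hα
  set β : ℝ := 1 + 2 * x * Real.cos (11 * Real.pi / 24) with hβ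
  set ω : ℂ := Complex.exp (2 * Real.pi * Complex.I / 3) with hω
  have x0 : 0 ≤ x := nfb_xc_pos.le
  have hω1 : ‖ω‖ = 1 := norm_omega
  -- the six sums
  set S0 := ∑ γ : HexMidEdgeSAW Λ a s(v, w₀), if v ∉ γ.verts then γ.weight x (5 / 8) * ((α - Real.sqrt 3 * x *
    ∑ δ : HexMidEdgeSAW ((Λ \ γ.verts.toFinset).erase v) s(v, w₁) s(v, w₂), x ^ δ.length : ℝ) : ℂ) else 0 with hS0
  set S1 := ∑ γ : HexMidEdgeSAW Λ a s(v, w₁), if v ∉ γ.verts then γ.weight x (5 / 8) * ((α - Real.sqrt 3 * x *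
    ∑ δ : HexMidEdgeSAW ((Λ \ γ.verts.toFinset).erase v) s(v, w₂) s(v, w₀), x ^ δ.length : ℝ) : ℂ) else 0 with hS1
  set S2 := ∑ γ : HexMidEdgeSAW Λ a s(v, w₂), if v ∉ γ.verts then γ.weight x (5 / 8) * ((α - Real.sqrt 3 * x *
    ∑ δ : HexMidEdgeSAW ((Λ \ γ.verts.toFinset).erase v) s(v, w₀) s(v, w₁), x ^ δ.length : ℝ) : ℂ) else 0 with hS2
  set B0 := ∑ γ : HexMidEdgeSAW Λ a s(v, w₀), if v ∉ γ.verts then γ.weight x (5 / 8) * ((β + Real.sqrt 3 * x *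
    ∑ δ : HexMidEdgeSAW ((Λ \ γ.verts.toFinset).erase v) s(v, w₁) s(v, w₂), x ^ δ.length : ℝ) : ℂ) else 0 with hB0
  set B1 := ∑ γ : HexMidEdgeSAW Λ a s(v, w₁), if v ∉ γ.verts then γ.weight x (5 / 8) * ((β + Real.sqrt 3 * x *
    ∑ δ : HexMidEdgeSAW ((Λ \ γ.verts.toFinset).erase v) s(v, w₂) s(v, w₀), x ^ δ.length : ℝ) : ℂ) else 0 with hB1
  set B2 := ∑ γ : HexMidEdgeSAW Λ a s(v, w₂), if v ∉ γ.verts then γ.weight x (5 / 8) * ((β + Real.sqrt 3 * x *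
    ∑ δ : HexMidEdgeSAW ((Λ \ γ.verts.toFinset).erase v) s(v, w₀) s(v, w₁), x ^ δ.length : ℝ) : ℂ) else 0 with hB2
  -- the real dressed masses
  set s₀ : ℝ := ∑ γ : HexMidEdgeSAW Λ a s(v, w₀), if v ∉ γ.verts then x ^ γ.length *
    (α - Real.sqrt 3 * x * ∑ δ : HexMidEdgeSAW ((Λ \ γ.verts.toFinset).erase v) s(v, w₁) s(v, w₂), x ^ δ.length) else 0 with hs₀
  set s₁ : ℝ := ∑ γ : HexMidEdgeSAW Λ a s(v, w₁), if v ∉ γ.verts then x ^ γ.length *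
    (α - Real.sqrt 3 * x * ∑ δ : HexMidEdgeSAW ((Λ \ γ.verts.toFinset).erase v) s(v, w₂) s(v, w₀), x ^ δ.length) else 0 with hs₁
  set s₂ : ℝ := ∑ γ : HexMidEdgeSAW Λ a s(v, w₂), if v ∉ γ.verts then x ^ γ.length *
    (α - Real.sqrt 3 * x * ∑ δ : HexMidEdgeSAW ((Λ \ γ.verts.toFinset).erase v) s(v, w₀) s(v, w₁), x ^ δ.length) else 0 with hs₂
  set b₀ : ℝ := ∑ γ : HexMidEdgeSAW Λ a s(v, w₀), if v ∉ γ.verts then x ^ γ.length *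
    (β + Real.sqrt 3 * x * ∑ δ : HexMidEdgeSAW ((Λ \ γ.verts.toFinset).erase v) s(v, w₁) s(v, w₂), x ^ δ.length) else 0 with hb₀
  set b₁ : ℝ := ∑ γ : HexMidEdgeSAW Λ a s(v, w₁), if v ∉ γ.verts then x ^ γ.length *
    (β + Real.sqrt 3 * x * ∑ δ : HexMidEdgeSAW ((Λ \ γ.verts.toFinset).erase v) s(v, w₂) s(v, w₀), x ^ δ.length) else 0 with hb₁
  set b₂ : ℝ := ∑ γ : HexMidEdgeSAW Λ a s(v, w₂), if v ∉ γ.verts then x ^ γ.length *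
    (β + Real.sqrt 3 * x * ∑ δ : HexMidEdgeSAW ((Λ \ γ.verts.toFinset).erase v) s(v, w₀) s(v, w₁), x ^ δ.length) else 0 with hb₂
  -- slit loop bounds (`≤ c`; slit domains are simply connected)
  have loop_bd : ∀ (e p q : HexVertex), hexGraph.Adj v e → hexGraph.Adj v p → hexGraph.Adj v q →
      e ≠ p → e ≠ q → p ≠ q → ∀ γ : HexMidEdgeSAW Λ a s(v, e), v ∉ γ.verts →
      0 ≤ ∑ δ : HexMidEdgeSAW ((Λ \ γ.verts.toFinset).erase v) s(v, p) s(v, q), x ^ δ.length ∧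
      (∑ δ : HexMidEdgeSAW ((Λ \ γ.verts.toFinset).erase v) s(v, p) s(v, q), x ^ δ.length) ≤ c := by
    intro e p q he hp hq hep heq hpq γ hγ
    refine ⟨Finset.sum_nonneg fun δ _ => pow_nonneg x0 _, ?_⟩
    have heγ : e ∈ γ.verts := mem_verts_of_firstArrival hva γ hγ
    have he' : e ∉ Λ \ γ.verts.toFinset := fun h =>
      (Finset.mem_sdiff.1 h).2 (List.mem_toFinset.2 heγ)
    have hv' : v ∈ Λ \ γ.verts.toFinset :=
      Finset.mem_sdiff.2 ⟨hv, fun h => hγ (List.mem_toFinset.1 h)⟩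
    exact HL _ (stub_slitSC Λ hΛ a ha _ γ) e v p q he' hv' he hp hq hep heq hpq
  -- termwise one-sided dressing facts
  have term_bd : ∀ Zγ : ℝ, 0 ≤ Zγ → Zγ ≤ c →
      0 ≤ α - Real.sqrt 3 * x * Zγ ∧
      6137 / 10000 * (α - Real.sqrt 3 * x * Zγ) ≤ β + Real.sqrt 3 * x * Zγ ∧
      β + Real.sqrt 3 * x * Zγ ≤ 1 * (α - Real.sqrt 3 * x * Zγ) :=
    fun Zγ hZ0 hZc => dressed_oneSided hc hZ0 hZc
  -- bounds on the real masses
  have L0 := fun (γ : HexMidEdgeSAW Λ a s(v, w₀)) (hγ : v ∉ γ.verts) =>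
    loop_bd w₀ w₁ w₂ h₀ h₁ h₂ h₀₁ h₀₂ h₁₂ γ hγ
  have L1 := fun (γ : HexMidEdgeSAW Λ a s(v, w₁)) (hγ : v ∉ γ.verts) =>
    loop_bd w₁ w₂ w₀ h₁ h₂ h₀ h₁₂ h₀₁.symm h₀₂.symm γ hγ
  have L2 := fun (γ : HexMidEdgeSAW Λ a s(v, w₂)) (hγ : v ∉ γ.verts) =>
    loop_bd w₂ w₀ w₁ h₂ h₀ h₁ h₀₂.symm h₁₂.symm h₀₁ γ hγ
  have hs0 : 0 ≤ s₀ := sum_ite_pow_mul_nonneg _ x0 _ fun γ hγ => (term_bd _ (L0 γ hγ).1 (L0 γ hγ).2).1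
  have hs1 : 0 ≤ s₁ := sum_ite_pow_mul_nonneg _ x0 _ fun γ hγ => (term_bd _ (L1 γ hγ).1 (L1 γ hγ).2).1
  have hs2 : 0 ≤ s₂ := sum_ite_pow_mul_nonneg _ x0 _ fun γ hγ => (term_bd _ (L2 γ hγ).1 (L2 γ hγ).2).1
  have hb0l : 6137 / 10000 * s₀ ≤ b₀ :=
    sum_ite_pow_mul_ge _ x0 _ _ fun γ hγ => (term_bd _ (L0 γ hγ).1 (L0 γ hγ).2).2.1
  have hb1l : 6137 / 10000 * s₁ ≤ b₁ :=
    sum_ite_pow_mul_ge _ x0 _ _ fun γ hγ => (term_bd _ (L1 γ hγ).1 (L1 γ hγ).2).2.1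
  have hb2l : 6137 / 10000 * s₂ ≤ b₂ :=
    sum_ite_pow_mul_ge _ x0 _ _ fun γ hγ => (term_bd _ (L2 γ hγ).1 (L2 γ hγ).2).2.1
  have hb0u' : b₀ ≤ 1 * s₀ := sum_ite_pow_mul_le _ x0 _ _ fun γ hγ => (term_bd _ (L0 γ hγ).1 (L0 γ hγ).2).2.2
  have hb1u' : b₁ ≤ 1 * s₁ := sum_ite_pow_mul_le _ x0 _ _ fun γ hγ => (term_bd _ (L1 γ hγ).1 (L1 γ hγ).2).2.2
  have hb2u' : b₂ ≤ 1 * s₂ := sum_ite_pow_mul_le _ x0 _ _ fun γ hγ => (term_bd _ (L2 γ hγ).1 (L2 γ hγ).2).2.2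
  have hb0u : b₀ ≤ s₀ := by rwa [one_mul] at hb0u'
  have hb1u : b₁ ≤ s₁ := by rwa [one_mul] at hb1u'
  have hb2u : b₂ ≤ s₂ := by rwa [one_mul] at hb2u'
  -- the rigid classes: ports `w₁, w₂` (through the door `{w₀, x}`)
  have cls := fun (p p' : HexVertex) (hp : hexGraph.Adj v p) (hp' : hexGraph.Adj v p')
      (hpw : p ≠ w₀) (hp'w : p' ≠ w₀) (γ : HexMidEdgeSAW Λ a s(v, p))
      (γ' : HexMidEdgeSAW Λ a s(v, p')) (hγ : v ∉ γ.verts) (hγ' : v ∉ γ'.verts) =>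
    depthTwo_classes hΛ ha hv hva hw₀ hw₀a h₀.symm hwx hwy hvx hxy hvy hx hp hp' hpw hp'w γ γ' hγ hγ'
  -- the port `w₀` itself
  have cls0 := fun (p : HexVertex) (hp : hexGraph.Adj v p) (hpw : p ≠ w₀)
      (γw : HexMidEdgeSAW Λ a s(v, w₀)) (γ : HexMidEdgeSAW Λ a s(v, p))
      (hγw : v ∉ γw.verts) (hγ : v ∉ γ.verts) =>
    depthTwo_portClass hΛ ha hv hva hw₀ hw₀a h₀.symm hwx hwy hvx hxy hvy hx hp hpw γw γ hγw hγ
  -- the offset of the class of `w₀` relative to `w₁`: `δ₀ = (3ε' - 1)π/3`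
  set δ₀ : ℝ := (3 * ε' - 1) * (Real.pi / 3) with hδ₀
  have hW0_of : ∀ (γ₀ : HexMidEdgeSAW Λ a s(v, w₀)) (γ₁ : HexMidEdgeSAW Λ a s(v, w₁)),
      v ∉ γ₀.verts → v ∉ γ₁.verts → γ₀.winding = γ₁.winding + δ₀ := by
    intro γ₀ γ₁ hγ₀ hγ₁
    have h := cls0 w₁ h₁ h₀₁.symm γ₀ γ₁ hγ₀ hγ₁
    rw [winding_center_center_mid, winding_center_center_mid', Tyv, Tyx, T10, Tvx] at h
    rw [hδ₀]; linarith
  have hW02_of : ∀ (γ₀ : HexMidEdgeSAW Λ a s(v, w₀)) (γ₂ : HexMidEdgeSAW Λ a s(v, w₂)),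
      v ∉ γ₀.verts → v ∉ γ₂.verts → γ₀.winding = γ₂.winding + 2 * Real.pi / 3 + δ₀ := by
    intro γ₀ γ₂ hγ₀ hγ₂
    have h := cls0 w₂ h₂ h₀₂.symm γ₀ γ₂ hγ₀ hγ₂
    rw [winding_center_center_mid, winding_center_center_mid', Tyv, Tyx, T20, Tvx] at h
    rw [hδ₀]; linarith
  have hW : ∃ W : ℝ, (∀ γ : HexMidEdgeSAW Λ a s(v, w₁), v ∉ γ.verts → γ.winding = W) ∧
      (∀ γ : HexMidEdgeSAW Λ a s(v, w₂), v ∉ γ.verts → γ.winding = W + -(2 * Real.pi / 3)) ∧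
      (∀ γ : HexMidEdgeSAW Λ a s(v, w₀), v ∉ γ.verts → γ.winding = W + δ₀) := by
    by_cases hex₁ : ∃ γ₁ : HexMidEdgeSAW Λ a s(v, w₁), v ∉ γ₁.verts
    · obtain ⟨γ₁, hγ₁⟩ := hex₁
      refine ⟨γ₁.winding, fun γ hγ => ?_, fun γ hγ => ?_, fun γ hγ => hW0_of γ γ₁ hγ hγ₁⟩
      · have h := cls w₁ w₁ h₁ h₁ h₀₁.symm h₀₁.symm γ γ₁ hγ hγ₁
        linarith
      · have h := cls w₁ w₂ h₁ h₂ h₀₁.symm h₀₂.symm γ₁ γ hγ₁ hγ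
        rw [T10, T20] at h
        linarith
    · push Not at hex₁
      by_cases hex₂ : ∃ γ₂ : HexMidEdgeSAW Λ a s(v, w₂), v ∉ γ₂.verts
      · obtain ⟨γ₂, hγ₂⟩ := hex₂
        refine ⟨γ₂.winding + 2 * Real.pi / 3, fun γ hγ => absurd (hex₁ γ) hγ, fun γ hγ => ?_,
          fun γ hγ => ?_⟩
        · have h := cls w₂ w₂ h₂ h₂ h₀₂.symm h₀₂.symm γ γ₂ hγ hγ₂
          linarith
        · have h := hW02_of γ γ₂ hγ hγ₂
          linarith
      · push Not at hex₂
        by_cases hex₀ : ∃ γ₀ : HexMidEdgeSAW Λ a s(v, w₀), v ∉ γ₀.verts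
        · obtain ⟨γ₀, hγ₀⟩ := hex₀
          refine ⟨γ₀.winding - δ₀, fun γ hγ => absurd (hex₁ γ) hγ, fun γ hγ => absurd (hex₂ γ) hγ,
            fun γ hγ => ?_⟩
          obtain ⟨L, hL0⟩ := verts_eq_of_touching hva hw₀a h₀.symm hwx hwy hvx hxy hvy hx γ hγ
          obtain ⟨L', hL0'⟩ := verts_eq_of_touching hva hw₀a h₀.symm hwx hwy hvx hxy hvy hx γ₀ hγ₀
          obtain ⟨γ', -, hw'⟩ := exists_retarget hw₀a hx γ hL0
          obtain ⟨γ₀', -, hw₀'⟩ := exists_retarget hw₀a hx γ₀ hL0'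
          have hrig := HexMidEdgeSAW.winding_eq_of_mem_boundary hΛ ha
            (door_mem_hexDomainBoundary hx hw₀ hwx) γ' γ₀'
          rw [hw', hw₀'] at hrig
          linarith
        · push Not at hex₀
          exact ⟨0, fun γ hγ => absurd (hex₁ γ) hγ, fun γ hγ => absurd (hex₂ γ) hγ,
            fun γ hγ => absurd (hex₀ γ) hγ⟩
  obtain ⟨W, hW₁, hW₂, hW₀⟩ := hW
  -- phase factorisations
  have E1S : S1 = Complex.exp (-Complex.I * (5 / 8 : ℝ) * W) * (s₁ : ℂ) :=
    sum_ite_weight_mul_eq _ W x (5 / 8) _ hW₁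
  have E1B : B1 = Complex.exp (-Complex.I * (5 / 8 : ℝ) * W) * (b₁ : ℂ) :=
    sum_ite_weight_mul_eq _ W x (5 / 8) _ hW₁
  have E2S : S2 = Complex.exp (-Complex.I * (5 / 8 : ℝ) * ((W + -(2 * Real.pi / 3) : ℝ) : ℂ)) * (s₂ : ℂ) :=
    sum_ite_weight_mul_eq _ (W + -(2 * Real.pi / 3)) x (5 / 8) _ hW₂
  have E2B : B2 = Complex.exp (-Complex.I * (5 / 8 : ℝ) * ((W + -(2 * Real.pi / 3) : ℝ) : ℂ)) * (b₂ : ℂ) :=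
    sum_ite_weight_mul_eq _ (W + -(2 * Real.pi / 3)) x (5 / 8) _ hW₂
  have E0S : S0 = Complex.exp (-Complex.I * (5 / 8 : ℝ) * ((W + δ₀ : ℝ) : ℂ)) * (s₀ : ℂ) :=
    sum_ite_weight_mul_eq _ (W + δ₀) x (5 / 8) _ hW₀
  have E0B : B0 = Complex.exp (-Complex.I * (5 / 8 : ℝ) * ((W + δ₀ : ℝ) : ℂ)) * (b₀ : ℂ) :=
    sum_ite_weight_mul_eq _ (W + δ₀) x (5 / 8) _ hW₀
  set e : ℂ := Complex.exp (-Complex.I * (5 / 8 : ℝ) * W) with he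
  have hen : ‖e‖ = 1 := by
    rw [he, show -Complex.I * (5 / 8 : ℝ) * (W : ℂ) = ((-((5 / 8 : ℝ) * W) : ℝ) : ℂ) * Complex.I by
      push_cast; ring, Complex.norm_exp_ofReal_mul_I]
  set Q : ℂ := Complex.exp ((5 * Real.pi / 12 : ℝ) * Complex.I) with hQ
  set Qb : ℂ := Complex.exp (-((5 * Real.pi / 12 : ℝ) * Complex.I)) with hQb
  have hQn : ‖Q‖ = 1 := by rw [hQ, Complex.norm_exp_ofReal_mul_I]
  have hQsigma : Complex.exp (Complex.I * (5 / 8 : ℝ) * ((2 * Real.pi / 3 : ℝ) : ℂ)) = Q := by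
    rw [hQ]; exact exp_sigma_eq
  rw [E0S, E0B, E1S, E1B, E2S, E2B, exp_sub_phase, hQsigma] at H1
  rcases hε' with rfl | rfl
  · /- `y → w₀ → v` turns LEFT: `δ₀ = 2π/3`, classes `(w₂, w₁, w₀)` consecutive, middle port `w₁` -/
    refine ⟨fun _ => ?_, fun hright => ?_⟩
    swap
    · exfalso
      rw [hright] at Tyv
      have := Real.pi_pos
      linarith
    have hδ : δ₀ = 2 * Real.pi / 3 := by rw [hδ₀]; ring
    have hph : Complex.exp (-Complex.I * (5 / 8 : ℝ) * ((W + δ₀ : ℝ) : ℂ)) = e * Qb := by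
      rw [exp_add_phase, hδ, hQb, exp_neg_sigma_eq]
    rw [hph] at H1
    have eL : e * Qb * (b₀ : ℂ) + ω * (e * (b₁ : ℂ)) + ω ^ 2 * (e * Q * (b₂ : ℂ)) =
        ω * e * ((b₁ : ℂ) + b₂ * (ω * Q) + b₀ * (ω ^ 2 * Qb)) := by
      have hω3 : ω ^ 3 = 1 := omega_pow_three
      linear_combination (-(e * Qb * (b₀ : ℂ))) * hω3
    have eR : e * Qb * (s₀ : ℂ) + e * (s₁ : ℂ) + e * Q * (s₂ : ℂ) = e * ((s₁ : ℂ) + s₂ * Q + s₀ * Qb) := by ring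
    rw [eL, eR] at H1
    simp only [norm_mul, hω1, hen, one_mul] at H1
    rw [hω, hQ, hQb, omega_mul_expQ, omega_sq_mul_exp_neg] at H1
    have key := three_class_necessary hs1 hs2 hs0 hk.le hb1u hb2l hb0l H1
    rwa [min_comm, max_comm] at key
  · /- `y → w₀ → v` turns RIGHT: `δ₀ = -4π/3`, classes `(w₀, w₂, w₁)` consecutive, middle port `w₂` -/
    refine ⟨fun hleft => ?_, fun _ => ?_⟩
    · exfalso
      rw [hleft] at Tyv
      have := Real.pi_pos
      linarith
    have hδ : δ₀ = -(4 * Real.pi / 3) := by rw [hδ₀]; ring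
    have hph : Complex.exp (-Complex.I * (5 / 8 : ℝ) * ((W + δ₀ : ℝ) : ℂ)) = e * Q ^ 2 := by
      rw [exp_add_phase, hδ, hQ, exp_neg_sigma_neg_four_pi_div_three]
    rw [hph] at H1
    have eL : e * Q ^ 2 * (b₀ : ℂ) + ω * (e * (b₁ : ℂ)) + ω ^ 2 * (e * Q * (b₂ : ℂ)) =
        ω ^ 2 * Q * e * ((b₂ : ℂ) + b₀ * (ω * Q) + b₁ * (ω ^ 2 * Qb)) := by
      have hω3 : ω ^ 3 = 1 := omega_pow_three
      have hQQ : Q * Qb = 1 := by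
        rw [hQ, hQb, ← Complex.exp_add, add_neg_cancel, Complex.exp_zero]
      linear_combination (-(e * Q ^ 2 * (b₀ : ℂ)) - e * (b₁ : ℂ) * ω * Q * Qb) * hω3 +
        (-(e * (b₁ : ℂ) * ω)) * hQQ
    have eR : e * Q ^ 2 * (s₀ : ℂ) + e * (s₁ : ℂ) + e * Q * (s₂ : ℂ) =
        Q * e * ((s₂ : ℂ) + s₀ * Q + s₁ * Qb) := by
      have hQQ : Q * Qb = 1 := by
        rw [hQ, hQb, ← Complex.exp_add, add_neg_cancel, Complex.exp_zero]
      linear_combination (-(e * (s₁ : ℂ))) * hQQ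
    rw [eL, eR] at H1
    simp only [norm_mul, norm_pow, hω1, hQn, hen, one_pow, one_mul] at H1
    rw [hω, hQ, hQb, omega_mul_expQ, omega_sq_mul_exp_neg] at H1
    exact three_class_necessary hs2 hs0 hs1 hk.le hb2u hb0l hb1l H1

end Summit.CriticalPhenomena.SAWScalingLimit.Theorems.SAWDevelopingMapNoFoldBound
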